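import Summits.CriticalPhenomena.CardyFormulaZ2.Theorems.CardyComplexConeEdgePrecompactUFRSEvents

/-!
# Junction weights of the boundary grid and dyadic bookkeeping for the collar decay on rectangles
(line `qkz-strip-boundary-arm` of crux `CardyComplexCone.EdgePrecompact`, stmt-CriticalPhenomena-11387;
fifth support file of the registered sub-goal `ufrs_screenedCollarDecay_rect`, M3 of the UFRS road map)

Elementary real analysis for the summation of the per-box, per-scale bounds
`2^27 C₁⁴ (η/ŝ_p) (η/d)^{α/2} (d/ρ)^α` (`…UFRSCollarDecayRectScales.lean`) over the dyadic scales
`d = ρ/2/2/2^k` and over the points `p` of the boundary grid (`…UFRSCollarDecayRectGrid.lean`):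

* `exists_cappedJunctionDist` — every point `p` has a capped junction distance `ŝ ∈ [64η, ρ/2]`
  (no marked midpoint of the finite set `J` within `ŝ` when `ŝ > 64η`) with weight
  `η/ŝ ≤ 2η/ρ + Σ_{m ∈ J} η / max (64η) (dist m p)`;
* `shellWeight_le`, `sum_shellWeight_le` (registered sub-goal) — reading a junction weight on the
  dyadic shells around a marked midpoint `m` and counting at most `16 T/η + 4` grid points within
  `T` of `m`: `Σ_{p ∈ G} η / max (64η) (dist m p) ≤ |G| · 2η/ρ + 33 · Jn` for `Jn ≥ 1` shells with
  `ρ/2 ≤ 2^Jn · 64η`;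
* `phi_dyadic_le` — `(η/d_k)^{α/2} (d_k/ρ)^α ≤ (η/ρ)^{α/2} (2^{-α/2})^k` (geometric in `k`);
* `shellCount_bounds` — with `Jn = Nat.log 2 ⌊ρ/η⌋ + 1`: `ρ/2 ≤ 2^Jn · 64η` and
  `Jn ≤ 1 + (ρ/η)^θ/(2^θ - 1)` for every `θ > 0` (Bernoulli), so that `(η/ρ)^{2θ} Jn → 0`.

References: H. Kesten, Comm. Math. Phys. 109 (1987) (dyadic summations of arm events);
G. Grimmett, *Percolation* (1999), §11.8.
-/

namespace Summit.CriticalPhenomena.CardyFormulaZ2.Cruxes.EdgePrecompact.QkzStripBoundaryArm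

open MeasureTheory Filter Set Metric
open scoped Topology BigOperators Pointwise
open Literature.Probability.LatticeModels Literature.Probability.Percolation
open Literature.Probability.RandomPlanarGeometry (DobrushinDomain)
open Summit.CriticalPhenomena.CardyFormulaZ2.Theses.CardyComplexCone

noncomputable section


/-! ## Junction weights of the grid points -/

/-- **Capped junction distance of a point.** Given the finite set `J` of marked midpoints, every
point `p` has a capped junction distance `ŝ ∈ [64η, ρ/2]`, junction-free below `ŝ` when
`ŝ > 64η`, whose weight `η/ŝ` is at most `2η/ρ + Σ_{m ∈ J} η / max (64η) (dist m p)`. -/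
theorem exists_cappedJunctionDist {E : DiscreteDobrushin} {w : Site 2} (J : Finset ℂ)
    (hJ : ∀ (z : ℂ) (ρ' : ℝ), (z ∈ ufrsMarkedNbhd E w ρ' ↔ ∃ m ∈ J, dist m z ≤ ρ'))
    {η ρ : ℝ} (hη : 0 < η) (hηρ : 128 * η ≤ ρ) (p : ℂ) :
    ∃ ŝ : ℝ, 64 * η ≤ ŝ ∧ ŝ ≤ ρ / 2 ∧
      (64 * η < ŝ → ∀ b' : ℝ, 2 * b' < ŝ → p ∉ ufrsMarkedNbhd E w (2 * b')) ∧
      η / ŝ ≤ 2 * η / ρ + ∑ m ∈ J, η / max (64 * η) (dist m p) := by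
  have hρ : 0 < ρ := by linarith
  have hsum : 0 ≤ ∑ m ∈ J, η / max (64 * η) (dist m p) :=
    Finset.sum_nonneg fun m _ => by positivity
  by_cases hnear : ∃ m ∈ J, dist m p < ρ / 2
  · obtain ⟨m₁, hm₁, hm₁ρ⟩ := hnear
    obtain ⟨m, hm, hmin⟩ := J.exists_min_image (fun m => dist m p) ⟨m₁, hm₁⟩
    have hmρ : dist m p < ρ / 2 := (hmin m₁ hm₁).trans_lt hm₁ρ
    refine ⟨max (64 * η) (dist m p), le_max_left _ _, max_le (by linarith) hmρ.le,
      fun h64 b' hb' hp => ?_, ?_⟩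
    · have hlt : 64 * η < dist m p := by
        rcases lt_max_iff.1 h64 with h | h
        · exact absurd h (lt_irrefl _)
        · exact h
      rw [max_eq_right hlt.le] at hb'
      obtain ⟨m', hm', hd'⟩ := (hJ p (2 * b')).1 hp
      linarith [hmin m' hm']
    · calc η / max (64 * η) (dist m p) ≤ ∑ m' ∈ J, η / max (64 * η) (dist m' p) :=
          Finset.single_le_sum (f := fun m' => η / max (64 * η) (dist m' p)) (fun m' _ => by positivity) hm
        _ ≤ 2 * η / ρ + ∑ m' ∈ J, η / max (64 * η) (dist m' p) := by
          linarith [div_pos (by linarith : (0:ℝ) < 2 * η) hρ]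
  · simp only [not_exists, not_and, not_lt] at hnear
    refine ⟨ρ / 2, by linarith, le_rfl, fun _ b' hb' hp => ?_, ?_⟩
    · obtain ⟨m', hm', hd'⟩ := (hJ p (2 * b')).1 hp
      linarith [hnear m' hm']
    · rw [show η / (ρ / 2) = 2 * η / ρ by field_simp]
      linarith

/-- A shell weight is read off dyadic shells: for `x ≥ 0`, `Jn ≥ 1` and `ρ/2 ≤ 2^Jn · 64η`,
`η / max (64η) x ≤ 2η/ρ + Σ_{j < Jn} [x ≤ 2^{j+1} 64η] / (64 · 2^j)`. -/
theorem shellWeight_le {η ρ x : ℝ} (hη : 0 < η) (hρ : 0 < ρ) {Jn : ℕ} (hJn1 : 1 ≤ Jn)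
    (hJn : ρ / 2 ≤ 2 ^ Jn * (64 * η)) :
    η / max (64 * η) x ≤ 2 * η / ρ +
      ∑ j ∈ Finset.range Jn, (if x ≤ 2 ^ (j + 1) * (64 * η) then 1 / (64 * (2:ℝ) ^ j) else 0) := by
  classical
  have hsum : 0 ≤ ∑ j ∈ Finset.range Jn, (if x ≤ 2 ^ (j + 1) * (64 * η) then 1 / (64 * (2:ℝ) ^ j) else 0) :=
    Finset.sum_nonneg fun j _ => by split_ifs <;> positivity
  have hmax0 : 0 < max (64 * η) x := lt_max_of_lt_left (by positivity)
  by_cases hxρ : ρ / 2 ≤ x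
  · have hx0 : 0 < x := by linarith
    have h1 : η / max (64 * η) x ≤ η / x := div_le_div_of_nonneg_left hη.le hx0 (le_max_right _ _)
    have h2 : η / x ≤ 2 * η / ρ := by rw [div_le_div_iff₀ hx0 hρ]; nlinarith
    linarith
  · rw [not_le] at hxρ
    have hex : ∃ j : ℕ, x ≤ 2 ^ (j + 1) * (64 * η) := by
      refine ⟨Jn - 1, ?_⟩
      rw [Nat.sub_add_cancel hJn1]; linarith
    set j₀ := Nat.find hex with hj₀
    have hj₀spec : x ≤ 2 ^ (j₀ + 1) * (64 * η) := Nat.find_spec hex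
    have hj₀Jn : j₀ < Jn := by
      have : j₀ ≤ Jn - 1 := Nat.find_min' hex (by rw [Nat.sub_add_cancel hJn1]; linarith)
      omega
    have hval : η / max (64 * η) x ≤ 1 / (64 * (2:ℝ) ^ j₀) := by
      by_cases h0 : j₀ = 0
      · rw [h0, pow_zero, mul_one]
        rw [div_le_div_iff₀ hmax0 (by norm_num)]
        nlinarith [le_max_left (64 * η) x]
      · obtain ⟨j', hj'⟩ : ∃ j', j₀ = j' + 1 := ⟨j₀ - 1, by omega⟩
        have hlt : ¬ x ≤ 2 ^ (j' + 1) * (64 * η) := Nat.find_min hex (by omega)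
        rw [← hj', not_le] at hlt
        have hpos : (0:ℝ) < 64 * 2 ^ j₀ := by positivity
        rw [div_le_div_iff₀ hmax0 hpos]
        nlinarith [le_max_right (64 * η) x]
    have hterm : (1 / (64 * (2:ℝ) ^ j₀) : ℝ) ≤
        ∑ j ∈ Finset.range Jn, (if x ≤ 2 ^ (j + 1) * (64 * η) then 1 / (64 * (2:ℝ) ^ j) else 0) := by
      have := Finset.single_le_sum (f := fun j => (if x ≤ 2 ^ (j + 1) * (64 * η) then 1 / (64 * (2:ℝ) ^ j) else 0))
        (fun j _ => by positivity) (Finset.mem_range.2 hj₀Jn)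
      simpa only [if_pos hj₀spec] using this
    have h2 : 0 ≤ 2 * η / ρ := by positivity
    linarith

/-- **Sum of the shell weights over the boundary grid.** If at most `16 T/η + 4` grid points lie
within `T` of any point, then for every `m`, `Σ_{p ∈ G} η / max (64η) (dist m p) ≤ |G| · 2η/ρ + 33 Jn`
(each of the `Jn` dyadic shells around `m` contributes at most `33`). -/
theorem sum_shellWeight_le : ∀ (G : Finset ℂ) (η ρ : ℝ) (m : ℂ) (Jn : ℕ), 0 < η → 0 < ρ → (∀ (m : ℂ) (T : ℝ), 0 ≤ T → ((G.filter (fun p => dist p m ≤ T)).card : ℝ) ≤ 16 * T / η + 4) → 1 ≤ Jn → ρ / 2 ≤ 2 ^ Jn * (64 * η) → ∑ p ∈ G, η / max (64 * η) (dist m p) ≤ G.card * (2 * η / ρ) + 33 * Jn := by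
  intro G η ρ m Jn hη hρ hGcnt hJn1 hJn
  classical
  have hpt : ∀ p ∈ G, η / max (64 * η) (dist m p) ≤ 2 * η / ρ +
      ∑ j ∈ Finset.range Jn, (if dist m p ≤ 2 ^ (j + 1) * (64 * η) then 1 / (64 * (2:ℝ) ^ j) else 0) :=
    fun p _ => shellWeight_le hη hρ hJn1 hJn
  refine (Finset.sum_le_sum hpt).trans ?_
  rw [Finset.sum_add_distrib, Finset.sum_const, nsmul_eq_mul, Finset.sum_comm]
  have hshell : ∀ j ∈ Finset.range Jn,
      ∑ p ∈ G, (if dist m p ≤ 2 ^ (j + 1) * (64 * η) then 1 / (64 * (2:ℝ) ^ j) else 0) ≤ 33 := by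
    intro j _
    rw [← Finset.sum_filter, Finset.sum_const, nsmul_eq_mul]
    have hcard := hGcnt m (2 ^ (j + 1) * (64 * η)) (by positivity)
    have heq : (G.filter (fun p => dist m p ≤ 2 ^ (j + 1) * (64 * η))) =
        (G.filter (fun p => dist p m ≤ 2 ^ (j + 1) * (64 * η))) :=
      Finset.filter_congr fun p _ => by rw [dist_comm]
    rw [heq]
    have h2j : (1:ℝ) ≤ 2 ^ j := one_le_pow₀ (by norm_num)
    have hpos : (0:ℝ) < 64 * 2 ^ j := by positivity
    calc ((G.filter (fun p => dist p m ≤ 2 ^ (j + 1) * (64 * η))).card : ℝ) * (1 / (64 * (2:ℝ) ^ j))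
        ≤ (16 * (2 ^ (j + 1) * (64 * η)) / η + 4) * (1 / (64 * (2:ℝ) ^ j)) :=
          mul_le_mul_of_nonneg_right hcard (by positivity)
      _ = 32 + 1 / (16 * (2:ℝ) ^ j) := by rw [pow_succ]; field_simp; ring
      _ ≤ 32 + 1 / 16 := by
          gcongr
          · linarith
      _ ≤ 33 := by norm_num
  calc (G.card : ℝ) * (2 * η / ρ) +
        ∑ j ∈ Finset.range Jn, ∑ p ∈ G, (if dist m p ≤ 2 ^ (j + 1) * (64 * η) then 1 / (64 * (2:ℝ) ^ j) else 0)
      ≤ (G.card : ℝ) * (2 * η / ρ) + ∑ j ∈ Finset.range Jn, (33 : ℝ) := by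
        gcongr with j hj
        exact hshell j hj
    _ = G.card * (2 * η / ρ) + 33 * Jn := by rw [Finset.sum_const, Finset.card_range, nsmul_eq_mul]; ring

/-! ## Dyadic bookkeeping -/

/-- **Geometric decay of the slack along the dyadic scales.** For `d_k = ρ/2/2/2^k`:
`(η/d_k)^{α/2} (d_k/ρ)^α ≤ (η/ρ)^{α/2} (2^{-α/2})^k` (halving `d` multiplies the left side by
`2^{α/2} 2^{-α} = 2^{-α/2}`). -/
theorem phi_dyadic_le {η ρ α : ℝ} (hη : 0 < η) (hρ : 0 < ρ) (hα : 0 < α) (k : ℕ) :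
    (η / (ρ / 2 / 2 / 2 ^ k)) ^ (α / 2) * (ρ / 2 / 2 / 2 ^ k / ρ) ^ α ≤
      (η / ρ) ^ (α / 2) * ((2:ℝ) ^ (-(α / 2))) ^ k := by
  induction k with
  | zero =>
    rw [pow_zero, pow_zero, mul_one, div_one]
    have h1 : (η / (ρ / 2 / 2)) ^ (α / 2) = (4:ℝ) ^ (α / 2) * (η / ρ) ^ (α / 2) := by
      rw [← Real.mul_rpow (by norm_num) (by positivity)]; congr 1; field_simp; ring
    have h2 : (ρ / 2 / 2 / ρ) ^ α = ((4:ℝ) ^ α)⁻¹ := by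
      rw [show ρ / 2 / 2 / ρ = (4:ℝ)⁻¹ by field_simp; ring, Real.inv_rpow (by norm_num)]
    rw [h1, h2]
    have h3 : (4:ℝ) ^ (α / 2) * ((4:ℝ) ^ α)⁻¹ ≤ 1 := by
      rw [← div_eq_mul_inv, div_le_one (by positivity)]
      exact Real.rpow_le_rpow_of_exponent_le (by norm_num) (by linarith)
    have h4 : 0 ≤ (η / ρ) ^ (α / 2) := by positivity
    calc (4:ℝ) ^ (α / 2) * (η / ρ) ^ (α / 2) * ((4:ℝ) ^ α)⁻¹
        = ((4:ℝ) ^ (α / 2) * ((4:ℝ) ^ α)⁻¹) * (η / ρ) ^ (α / 2) := by ring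
      _ ≤ 1 * (η / ρ) ^ (α / 2) := mul_le_mul_of_nonneg_right h3 h4
      _ = (η / ρ) ^ (α / 2) := one_mul _
  | succ k ih =>
    have hd : 0 < ρ / 2 / 2 / 2 ^ k := by positivity
    set d := ρ / 2 / 2 / 2 ^ k with hdd
    have e1 : ρ / 2 / 2 / 2 ^ (k + 1) = d / 2 := by rw [hdd, pow_succ]; field_simp
    have ha : (η / (d / 2)) ^ (α / 2) = (2:ℝ) ^ (α / 2) * (η / d) ^ (α / 2) := by
      rw [show η / (d / 2) = 2 * (η / d) by field_simp, Real.mul_rpow (by norm_num) (by positivity)]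
    have hb : (d / 2 / ρ) ^ α = (d / ρ) ^ α / (2:ℝ) ^ α := by
      rw [show d / 2 / ρ = (d / ρ) / 2 by ring, Real.div_rpow (by positivity) (by norm_num)]
    have hq : 0 ≤ (2:ℝ) ^ (-(α / 2)) := by positivity
    calc (η / (ρ / 2 / 2 / 2 ^ (k + 1))) ^ (α / 2) * (ρ / 2 / 2 / 2 ^ (k + 1) / ρ) ^ α
        = ((2:ℝ) ^ (α / 2) / (2:ℝ) ^ α) * ((η / d) ^ (α / 2) * (d / ρ) ^ α) := by rw [e1, ha, hb]; ring
      _ = (2:ℝ) ^ (-(α / 2)) * ((η / d) ^ (α / 2) * (d / ρ) ^ α) := by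
          rw [← Real.rpow_sub (by norm_num : (0:ℝ) < 2), show α / 2 - α = -(α / 2) by ring]
      _ ≤ (2:ℝ) ^ (-(α / 2)) * ((η / ρ) ^ (α / 2) * ((2:ℝ) ^ (-(α / 2))) ^ k) :=
          mul_le_mul_of_nonneg_left ih hq
      _ = (η / ρ) ^ (α / 2) * ((2:ℝ) ^ (-(α / 2))) ^ (k + 1) := by rw [pow_succ]; ring

/-- **The number of dyadic shells.** With `Jn = Nat.log 2 ⌊ρ/η⌋ + 1`: `ρ/2 ≤ 2^Jn · 64 η`, and for
every `θ ∈ (0, 1]`, `Jn ≤ 1 + (ρ/η)^θ / (2^θ - 1)` (Bernoulli's inequality for `(2^θ)^{Jn - 1} ≤ (ρ/η)^θ`). -/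
theorem shellCount_bounds {η ρ θ : ℝ} (hη : 0 < η) (hηρ : η ≤ ρ) (hθ : 0 < θ) :
    ρ / 2 ≤ 2 ^ (Nat.log 2 ⌊ρ / η⌋₊ + 1) * (64 * η) ∧
      ((Nat.log 2 ⌊ρ / η⌋₊ + 1 : ℕ) : ℝ) ≤ 1 + (ρ / η) ^ θ / ((2:ℝ) ^ θ - 1) := by
  set m := ⌊ρ / η⌋₊ with hm
  set n := Nat.log 2 m with hn
  have hx1 : 1 ≤ ρ / η := by rw [le_div_iff₀ hη]; linarith
  have hm1 : 1 ≤ m := Nat.le_floor (by exact_mod_cast hx1)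
  have h2θ : 1 < (2:ℝ) ^ θ := Real.one_lt_rpow (by norm_num) hθ
  constructor
  · have h1 : m < 2 ^ (n + 1) := Nat.lt_pow_succ_log_self one_lt_two m
    have h2 : ρ / η < m + 1 := Nat.lt_floor_add_one _
    have h3 : ((m : ℕ) : ℝ) + 1 ≤ (2:ℝ) ^ (n + 1) := by exact_mod_cast h1
    rw [div_lt_iff₀ hη] at h2
    have h4 : ((m:ℝ) + 1) * η ≤ (2:ℝ) ^ (n + 1) * η := mul_le_mul_of_nonneg_right h3 hη.le
    nlinarith [pow_pos (two_pos : (0:ℝ) < 2) (n + 1)]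
  · have h1 : 2 ^ n ≤ m := Nat.pow_log_le_self 2 (by omega)
    have h2 : ((2:ℝ) ^ n : ℝ) ≤ ρ / η := by
      have : ((2 ^ n : ℕ) : ℝ) ≤ m := by exact_mod_cast h1
      push_cast at this
      exact this.trans (Nat.floor_le (by positivity))
    -- Bernoulli
    have hB : 1 + (n : ℝ) * ((2:ℝ) ^ θ - 1) ≤ (1 + ((2:ℝ) ^ θ - 1)) ^ n :=
      one_add_mul_le_pow (by linarith) n
    rw [add_sub_cancel] at hB
    have h3 : ((2:ℝ) ^ θ) ^ n = ((2:ℝ) ^ n) ^ θ := by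
      rw [← Real.rpow_natCast, ← Real.rpow_mul (by norm_num), mul_comm, Real.rpow_mul (by norm_num),
        Real.rpow_natCast]
    have h4 : ((2:ℝ) ^ n) ^ θ ≤ (ρ / η) ^ θ := Real.rpow_le_rpow (by positivity) h2 hθ.le
    have h5 : (n : ℝ) * ((2:ℝ) ^ θ - 1) ≤ (ρ / η) ^ θ := by linarith [hB.trans (h3.le.trans h4)]
    have h6 : (n : ℝ) ≤ (ρ / η) ^ θ / ((2:ℝ) ^ θ - 1) := by rw [le_div_iff₀ (by linarith)]; exact h5
    push_cast
    linarith

end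

end Summit.CriticalPhenomena.CardyFormulaZ2.Cruxes.EdgePrecompact.QkzStripBoundaryArm
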